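import Summits.QuantumFields.BalabanUV.Beta.FP.DecimationSecondMoment
import Summits.QuantumFields.BalabanUV.Beta.FP.HorizontalBookkeeping

/-!
# `BalabanUV.Beta.FP.HorizontalTailAssembly` — road «FP» for binder row D1, row N7/H3-BOOK (b4′): THE ASSEMBLY OF THE HORIZONTAL BOOKKEEPING
# `hbook ⟸ (a) ∧ (b-T) ∧ (b3′) ∧ hgerm` — the windowed second moment of the step kernel defined by the horizontal identity (H1) stays within an
# N-UNIFORM constant of the window function `g N = M₂[K·1_{‖z‖∞≤N}]`

HONEST DEPENDENCY (page 1, mandatory): continuum YM on T⁴ ⇐ BetaPertH ∧ nine spine estimates (0/9 proved); BetaPertH ⇐ (D1) ∧ (D4) ∧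
CAP+tail; G-an2-4 gates asym, D1 and NE2/3/4.  HONEST FRAMING (cell contract, verbatim): «discharging `BetaPertH` makes Bałaban's UV
stability UNCONDITIONAL — a real constructive-QFT result; it is NOT the continuum limit and NOT the Clay problem.»  THIS MODULE is [folklore]
bookkeeping of limits of finite lattice sums on `ℤ⁴`; it asserts nothing about Bałaban's objects, cites nothing, mints no `Prop` fact, no `def`; 0 `sorry`.
EVERY analytic input is a HYPOTHESIS with its supplier named: (H1) the horizontal identity at kernel level (road FP row H1-KER = the shared composition
lane; model level `FP/HorizontalModel`), (a) the truncated transport (`FP/HorizontalBookkeeping`, leaf-02-g5 — by SHAPE: a `HasSum` with value `g N + E₀`,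
`|E₀| ≤ U₀`), (b-T) the transport comparison against the rescaled tail kernel (`FP/HorizontalBookkeepingTail*`, leaf-02-g6 — by SHAPE: a `HasSum` with
value `S`, `|S| ≤ U_T`, plus the pointwise split of the dressed kernel), and the log-asymptotics letter `hgerm` (road FP row H2-OBJ, owner).  (b3′) and the
«second bracket» are tree theorems (`FP/DecimationTail`, `FP/DecimationSecondMoment`).  FINDING F-d1leaf05g8-1: `hgerm` is NECESSARY here (decay alone
lets the defect drift like `log log N`).  NOT hbook-discharged (its letters are open), NOT hasym, NOT D1, NOT BetaPertH, NOT continuum, NOT Clay.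

ABSOLUTE RULE (cell charter, verbatim): «No internally-minted statement may enter as a cited fact. Every hypothesis is either kernel-proved in this
package or a verbatim quotation of a PUBLISHED theorem with page reference. The manuscript(s) under audit are NOT citable for their own disputed
steps — they are the thing under adjudication; programme-internal (2001/route/tribunal) claims are never citable.»

THE STATEMENT (`abs_secondMoment_sub_window_le`).  Data: kernels `K T D : Fin 4 → Fin 4 → ℤ⁴ → ℝ`, a channel `(μ, ν)`, a block size `N ≥ 1`, a transported
second-moment summand `X : ℤ⁴ → ℝ` (on the road: `v ↦ N⁸·dressedEntry w K (N•v) μ ν`) split as `X = Xtr + Xtl` (truncated + tail transports).  Hypotheses: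
(H1) `X v = T μ ν v + K μ ν v + D μ ν v` for all `v`; `Summable (v ↦ T μ ν v·v_μ·v_ν)`; `HasSum (v ↦ D μ ν v·v_μ·v_ν) 0`;
(a) `HasSum (v ↦ Xtr v·v_μ·v_ν) (g N + E₀)`, `|E₀| ≤ U₀`;  (b-T) `HasSum (v ↦ (Xtl v − Q v)·v_μ·v_ν) S`, `|S| ≤ U_T`, where the rescaled tail kernel is
`Q v = N⁶·K μ ν (N•v)` for `1 < ‖v‖∞` and `0` otherwise;  decay `|K μ ν z| ≤ C∕(‖z‖∞+1)⁶`, `|Δ_{e_i}K μ ν z| ≤ C∕(‖z‖∞+1)⁷`;  `hgerm : ∀ M ≥ 1,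
|g M − (s·log M + c₀)| ≤ Cg` with `g M := Σ_{0<‖z‖∞≤M} K μ ν z·z_μ·z_ν`.  CONCLUSION: `|secondMoment T μ ν − g N| ≤ U₀ + U_T + (3·Cg + 67392·C) + |c₀|`.
PROOF: exhaust `ℤ⁴` by the sup-norm boxes `box 4 R`; on each box the (H1)-split of `Σ v²T` has the pieces (a), (b-T), (D) converging and the «second bracket»
`Σ_{1<‖v‖≤R} N⁶K(N•v)v² − g R` within `3Cg + 67392C` of `−c₀` for EVERY `R` (`DecimationSecondMoment.abs_rescaled_window_sub_germ_le`); pass to the limit.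
Provenance: D1 formalisation swarm, unit b2b-balaban-beta-d1-formalise-leaf-05 gen 8 (prover-b2b-balaban-beta-d1-formalise-leaf-05-g8-0), 2026-08-20.
-/

noncomputable section

namespace Summit.QuantumFields.BalabanUV.Beta.FP.HorizontalTailAssembly

open Finset Filter Topology
open Literature.Probability.LatticeModels (box mem_box box_mono annulus mem_annulus)
open Literature.MathematicalPhysics.QuantumFieldTheory.Balaban1983to89
open Literature.MathematicalPhysics.QuantumFieldTheory.Balaban1983to89.Beta
open Literature.MathematicalPhysics.QuantumFieldTheory.Balaban1983to89.Beta.DyadicShell (Pt supNorm supNorm_le_iff natAbs_le_supNorm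
  exists_eq_supNorm mem_box_iff mem_annulus_iff annulus_eq_union disjoint_annulus)
open Summit.QuantumFields.BalabanUV.Beta.FP.DecimationSecondMoment (abs_rescaled_window_sub_germ_le)

/-! ## §1 Exhaustion of `ℤ⁴` by sup-norm boxes -/

/-- [folklore] The sup-norm boxes exhaust `ℤ⁴`: `box 4 R → ⊤` in the `Finset` order. -/
theorem tendsto_box_atTop : Tendsto (fun R : ℕ => box 4 R) atTop atTop :=
  tendsto_atTop_finset_of_monotone (box_mono 4) fun v => ⟨supNorm v, mem_box_iff.mpr le_rfl⟩

/-- [folklore] A `HasSum` over `ℤ⁴` is the limit of its box partial sums. -/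
theorem tendsto_sum_box_of_hasSum {f : Pt → ℝ} {a : ℝ} (h : HasSum f a) :
    Tendsto (fun R : ℕ => ∑ v ∈ box 4 R, f v) atTop (𝓝 a) :=
  h.comp tendsto_box_atTop

/-! ## §2 Box sums of the rescaled tail kernel and of the window weight -/

variable {K : Fin 4 → Fin 4 → Pt → ℝ} {μ ν : Fin 4}

/-- [folklore] The box sum of the RESCALED TAIL KERNEL `Q v := [1 < ‖v‖∞]·N⁶·K μ ν (N•v)` against `v_μ v_ν` is the shell sum over `1 < ‖v‖∞ ≤ R`. -/
theorem sum_box_rescaledTail_eq (N R : ℕ) :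
    ∑ v ∈ box 4 R, (if 1 < supNorm v then (N : ℝ) ^ 6 * K μ ν ((N : ℤ) • v) else 0) * (v μ : ℝ) * (v ν : ℝ)
      = ∑ v ∈ annulus 4 1 R, (N : ℝ) ^ 6 * K μ ν ((N : ℤ) • v) * (v μ : ℝ) * (v ν : ℝ) := by
  have hfilter : (box 4 R).filter (fun v => 1 < supNorm v) = annulus 4 1 R := by
    ext v
    rw [Finset.mem_filter, mem_box_iff, mem_annulus_iff]
    exact and_comm
  rw [← hfilter, Finset.sum_filter]
  refine Finset.sum_congr rfl fun v _ => ?_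
  split_ifs <;> simp

/-- [folklore] The box sum of the window weight `K μ ν z·z_μ·z_ν` is the punctured-box sum `Σ_{0 < ‖z‖∞ ≤ R}` (the origin carries weight zero). -/
theorem sum_box_window_eq (R : ℕ) :
    ∑ z ∈ box 4 R, K μ ν z * (z μ : ℝ) * (z ν : ℝ) = ∑ z ∈ annulus 4 0 R, K μ ν z * (z μ : ℝ) * (z ν : ℝ) := by
  have hfilter : (box 4 R).filter (fun v => 0 < supNorm v) = annulus 4 0 R := by
    ext v
    rw [Finset.mem_filter, mem_box_iff, mem_annulus_iff]
    exact and_comm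
  rw [← hfilter, Finset.sum_filter]
  refine Finset.sum_congr rfl fun v _ => ?_
  split_ifs with h
  · rfl
  · have hv : v = 0 := DyadicShell.supNorm_eq_zero_iff.mp (by omega)
    subst hv; simp

/-! ## §3 The assembly -/

/-- [folklore] **THE HORIZONTAL BOOKKEEPING ASSEMBLED** (`hbook ⟸ (a) ∧ (b-T) ∧ (b3′) ∧ hgerm`; see the module docstring for the reading of each
hypothesis and its supplier).  For every block size `N ≥ 1`:
`|secondMoment T μ ν − Σ_{0<‖z‖∞≤N} K μ ν z·z_μ·z_ν| ≤ U₀ + U_T + (3·Cg + 67392·C) + |c₀|`. -/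
theorem abs_secondMoment_sub_window_le {T D : Fin 4 → Fin 4 → Pt → ℝ} {N : ℕ} (hN : 1 ≤ N)
    {X Xtr Xtl : Pt → ℝ} (hX : ∀ v, X v = Xtr v + Xtl v)
    -- (H1) the horizontal identity at kernel level, with an `M₂`-invisible bookkeeping term `D` and a summable step kernel `T`
    (hH1 : ∀ v, X v = T μ ν v + K μ ν v + D μ ν v)
    (hT : Summable fun v : Pt => T μ ν v * (v μ : ℝ) * (v ν : ℝ))
    (hD : HasSum (fun v : Pt => D μ ν v * (v μ : ℝ) * (v ν : ℝ)) 0)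
    -- (a) the truncated transport: value = window function + a bounded defect
    {E₀ U₀ : ℝ}
    (ha : HasSum (fun v : Pt => Xtr v * (v μ : ℝ) * (v ν : ℝ)) ((∑ z ∈ annulus 4 0 N, K μ ν z * (z μ : ℝ) * (z ν : ℝ)) + E₀))
    (hE₀ : |E₀| ≤ U₀)
    -- (b-T) the transport comparison against the rescaled tail kernel
    {S U_T : ℝ}
    (hb : HasSum (fun v : Pt =>
      (Xtl v - (if 1 < supNorm v then (N : ℝ) ^ 6 * K μ ν ((N : ℤ) • v) else 0)) * (v μ : ℝ) * (v ν : ℝ)) S)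
    (hS : |S| ≤ U_T)
    -- decay of the kernel and the log-asymptotics letter of the window function
    {C : ℝ} (hC : 0 ≤ C) (hK : ∀ z : Pt, |K μ ν z| ≤ C / ((supNorm z : ℝ) + 1) ^ 6)
    (hdK : ∀ (z : Pt) (i : Fin 4), |K μ ν (z + Pi.single i 1) - K μ ν z| ≤ C / ((supNorm z : ℝ) + 1) ^ 7)
    {s c₀ Cg : ℝ}
    (hgerm : ∀ M : ℕ, 1 ≤ M → |∑ z ∈ annulus 4 0 M, K μ ν z * (z μ : ℝ) * (z ν : ℝ) - (s * Real.log M + c₀)| ≤ Cg) :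
    |B12Beta.secondMoment T μ ν - ∑ z ∈ annulus 4 0 N, K μ ν z * (z μ : ℝ) * (z ν : ℝ)|
      ≤ U₀ + U_T + (3 * Cg + 67392 * C) + |c₀| := by
  -- abbreviations
  set g : ℕ → ℝ := fun M => ∑ z ∈ annulus 4 0 M, K μ ν z * (z μ : ℝ) * (z ν : ℝ) with hg
  set Q : Pt → ℝ := fun v => if 1 < supNorm v then (N : ℝ) ^ 6 * K μ ν ((N : ℤ) • v) else 0 with hQ
  set B₃ : ℝ := 3 * Cg + 67392 * C with hB₃
  -- the box partial sums
  set PT : ℕ → ℝ := fun R => ∑ v ∈ box 4 R, T μ ν v * (v μ : ℝ) * (v ν : ℝ)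
  set Pa : ℕ → ℝ := fun R => ∑ v ∈ box 4 R, Xtr v * (v μ : ℝ) * (v ν : ℝ)
  set Pb : ℕ → ℝ := fun R => ∑ v ∈ box 4 R, (Xtl v - Q v) * (v μ : ℝ) * (v ν : ℝ)
  set PD : ℕ → ℝ := fun R => ∑ v ∈ box 4 R, D μ ν v * (v μ : ℝ) * (v ν : ℝ)
  set Pbr : ℕ → ℝ := fun R => ∑ v ∈ annulus 4 1 R, (N : ℝ) ^ 6 * K μ ν ((N : ℤ) • v) * (v μ : ℝ) * (v ν : ℝ) - g R
  -- the (H1)-split of the box sums: `PT = Pa + Pb + Pbr − PD`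
  have hsplit : ∀ R, PT R - Pa R - Pb R + PD R = Pbr R := by
    intro R
    have hQsum := sum_box_rescaledTail_eq (K := K) (μ := μ) (ν := ν) N R
    have hKsum := sum_box_window_eq (K := K) (μ := μ) (ν := ν) R
    simp only [PT, Pa, Pb, PD, Pbr, hg]
    rw [← hKsum, ← hQsum, ← Finset.sum_sub_distrib, ← Finset.sum_sub_distrib, ← Finset.sum_add_distrib, ← Finset.sum_sub_distrib]
    refine Finset.sum_congr rfl fun v _ => ?_
    have h1 := hH1 v
    have h2 := hX v
    simp only [hQ]
    rw [h2] at h1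
    -- `T w − Xtr w − (Xtl − Q) w + D w = Q w − K w`
    have : T μ ν v = Xtr v + Xtl v - K μ ν v - D μ ν v := by linarith
    rw [this]; ring
  -- limits of the four convergent pieces along the boxes
  have hPT : Tendsto PT atTop (𝓝 (B12Beta.secondMoment T μ ν)) := tendsto_sum_box_of_hasSum hT.hasSum
  have hPa : Tendsto Pa atTop (𝓝 (g N + E₀)) := tendsto_sum_box_of_hasSum ha
  have hPb : Tendsto Pb atTop (𝓝 S) := tendsto_sum_box_of_hasSum hb
  have hPD : Tendsto PD atTop (𝓝 0) := tendsto_sum_box_of_hasSum hD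
  -- hence the bracket converges
  have hbr : Tendsto Pbr atTop (𝓝 (B12Beta.secondMoment T μ ν - (g N + E₀) - S + 0)) := by
    have := ((hPT.sub hPa).sub hPb).add hPD
    refine this.congr fun R => ?_
    exact hsplit R
  -- and it is within `B₃` of `−c₀` for every `R ≥ 1`
  have hbound : ∀ R : ℕ, 1 ≤ R → |Pbr R + c₀| ≤ B₃ := by
    intro R hR
    have h := abs_rescaled_window_sub_germ_le (μ := μ) (ν := ν) hC hK hdK hgerm hN hR
    simp only [Pbr, hg]
    have e : ∑ v ∈ annulus 4 1 R, (N : ℝ) ^ 6 * K μ ν ((N : ℤ) • v) * (v μ : ℝ) * (v ν : ℝ)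
        - ∑ z ∈ annulus 4 0 R, K μ ν z * (z μ : ℝ) * (z ν : ℝ) + c₀
        = ∑ v ∈ annulus 4 1 R, (N : ℝ) ^ 6 * K μ ν ((N : ℤ) • v) * (v μ : ℝ) * (v ν : ℝ)
          - (∑ z ∈ annulus 4 0 R, K μ ν z * (z μ : ℝ) * (z ν : ℝ) - c₀) := by ring
    rw [e]; exact h
  -- pass to the limit in the two-sided bound
  set L : ℝ := B12Beta.secondMoment T μ ν - (g N + E₀) - S + 0 with hL
  have hupper : L + c₀ ≤ B₃ := by
    have ht : Tendsto (fun R => Pbr R + c₀) atTop (𝓝 (L + c₀)) := hbr.add_const c₀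
    exact le_of_tendsto ht (Filter.eventually_atTop.mpr ⟨1, fun R hR => (abs_le.mp (hbound R hR)).2⟩)
  have hlower : -B₃ ≤ L + c₀ := by
    have ht : Tendsto (fun R => Pbr R + c₀) atTop (𝓝 (L + c₀)) := hbr.add_const c₀
    exact ge_of_tendsto ht (Filter.eventually_atTop.mpr ⟨1, fun R hR => (abs_le.mp (hbound R hR)).1⟩)
  -- conclude
  have e : B12Beta.secondMoment T μ ν - g N = E₀ + S + (L + c₀) - c₀ := by rw [hL]; ring
  rw [e]
  have hLc : |L + c₀| ≤ B₃ := abs_le.mpr ⟨hlower, hupper⟩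
  calc |E₀ + S + (L + c₀) - c₀| ≤ |E₀ + S + (L + c₀)| + |c₀| := abs_sub _ _
    _ ≤ |E₀| + |S| + |L + c₀| + |c₀| := by
        have := abs_add_le (E₀ + S) (L + c₀)
        have := abs_add_le E₀ S
        linarith
    _ ≤ U₀ + U_T + (3 * Cg + 67392 * C) + |c₀| := by rw [← hB₃]; linarith

/-! ## §4 The (a)-socket BY NAME: leaf-02-g5's truncated transport identity in the assembly's shape -/

open DecimatedMomentSummable (ConstReproSum LinReproSum AbsMoment₂)
open DressedMomentNormalisation (EKer dressedEntry)
open Summit.QuantumFields.BalabanUV.Beta.FP.HorizontalBookkeeping (truncK truncK_apply t0Defect hasSum_coarse_secondMoment_truncK)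

/-- [folklore] **THE (a) HYPOTHESIS OF `abs_secondMoment_sub_window_le` IS leaf-02-g5's `hasSum_coarse_secondMoment_truncK` BY NAME**: for an
admissible transport `w` (Kronecker masses, (L1∞) with constants `Cw`, absolutely summable second moments) and an EVEN kernel `K`, the truncated
transport `Xtr v := N⁸·dressedEntry w (truncK K N) (N•v) μ ν` has `HasSum (Xtr·v_μ·v_ν) (g N + E₀)` with the DISPLAYED defect
`E₀ := N⁶·t0Defect N w (truncK K N) Cw μ ν μ ν` (bounded by `HorizontalBookkeeping.pow_six_mul_abs_t0Defect_le` under the profile letters). -/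
theorem hasSum_truncatedTransport {N : ℕ} (hN : 1 ≤ N) (w : EKer 4) (K : EKer 4) (Cw : Fin 4 → Fin 4 → Fin 4 → ℝ)
    (hw0 : ∀ κ l, ConstReproSum N (w κ l) (if κ = l then (((N : ℝ) ^ (4 + 1))⁻¹) else 0))
    (hw1 : ∀ κ l, LinReproSum N (w κ l) (Cw κ l)) (hwA : ∀ κ l, AbsMoment₂ (w κ l))
    (heven : ∀ c e t, K c e (-t) = K c e t) (μ ν : Fin 4) :
    HasSum (fun v : Pt => ((N : ℝ) ^ 8 * dressedEntry w (truncK K N) ((N : ℤ) • v) μ ν) * (v μ : ℝ) * (v ν : ℝ))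
      ((∑ z ∈ annulus 4 0 N, K μ ν z * (z μ : ℝ) * (z ν : ℝ)) + (N : ℝ) ^ 6 * t0Defect N w (truncK K N) Cw μ ν μ ν) := by
  have h := hasSum_coarse_secondMoment_truncK (Nat.lt_of_lt_of_le Nat.zero_lt_one hN) w K N Cw hw0 hw1 hwA heven μ ν μ ν
  -- the value: `Σ_{t ∈ box N} (t_μ t_ν) • truncK K N μ ν t = Σ_{0<‖z‖≤N} K μ ν z·z_μ·z_ν`
  have hval : ∑ t ∈ box 4 N, (t μ * t ν) • truncK K N μ ν t = ∑ z ∈ annulus 4 0 N, K μ ν z * (z μ : ℝ) * (z ν : ℝ) := by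
    rw [← sum_box_window_eq (K := K) (μ := μ) (ν := ν) N]
    refine Finset.sum_congr rfl fun t ht => ?_
    have htN : supNorm t ≤ N := mem_box_iff.mp ht
    rw [truncK_apply, if_pos htN, zsmul_eq_mul]
    push_cast; ring
  rw [hval] at h
  refine h.congr_fun fun v => ?_
  push_cast; ring

end Summit.QuantumFields.BalabanUV.Beta.FP.HorizontalTailAssembly

end
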